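import Literature.Computability.AlgebraicComplexity.DeterminantIrreducible
import Mathlib.Tactic.LinearCombination
import HarnessLib

/-!
# The determinant class of a twist: commutative algebra

Route `FarEdgeDescent` (cell `decomp-mm`, lens 2 «structural dichotomy (special vs generic)»,
gen 32), Kernel VII-det part 1; support for the aside `SubLogRate` (stmt-MatrixMultiplication-25371).

The DEGENERATION obstruction separating the sign twists `𝔖^♭`, `𝔖^{♭ᵀ}` from `⟨2,2,2⟩`
(`FarEdgeDescentSignTwistDet.lean`) compares the determinants of the generic `X`-slices:
`det(X ⊕ X^♭) = det X · perm X` against `det(X ⊕ X) = (det X)²`.  Under a degeneration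
`ε^h ⟨2,2,2⟩ + O(ε^{h+1}) = (A(ε) ⊗ B(ε) ⊗ C(ε))·𝔖^♭` one gets an exact identity
`ε^{4h}·((det X)² + O(ε)) = c(ε) · det Y(ε) · perm Y(ε)` in `K[x][ε]`, `Y(ε) = B(ε)ᵀx` a matrix
of linear forms with coefficients in `K[ε]`; comparing TRAILING coefficients (`K[x][ε]` is a domain)
gives `(det X)² = w · P · Q` with `P`, `Q` the trailing coefficients of `u - v`, `u + v`
(`u = y₀₀y₁₁`, `v = y₀₁y₁₀`).  This file supplies the algebra that makes this absurd:

* `detX_prime`: `det X = x₀₀x₁₁ - x₀₁x₁₀` is prime in `K[x]` (the tree's `prime_det_of_X`);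
* `linear_mul_linear_ne_C_mul_detX`: a product of two linear forms is never a non-zero multiple of
  `det X` (prime of degree `2` does not divide a non-zero linear form);
* `pair_eq_C_mul_detX`: `(det X)² = C w · P · Q` with `P`, `Q` quadratic forms forces
  `P = κ₁ det X`, `Q = κ₂ det X` (unique factorisation + degrees);
* `trailing_contradiction`: if all `ε`-coefficients of the `y_b` are linear forms and the trailing
  coefficients of `y₀₀y₁₁ ∓ y₀₁y₁₀` are `κ∓ · det X` (`κ∓ ≠ 0`), contradiction (characteristic
  `≠ 2`): at the least order `m₀ = min(ord u, ord v)` the coefficients of `u`, `v` are `0` or genuine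
  products of two linear forms, and `(a - b, a + b)` pins both to multiples of `det X`.

References: P. Bürgisser, M. Clausen, M. A. Shokrollahi, *Algebraic Complexity Theory* (1997),
§15.4 (degeneration), §20.2 [BurgisserClausenShokrollahi1997]; V. Strassen, J. reine angew. Math.
375/376 (1987), §4 [Strassen1987].
-/

noncomputable section

open scoped BigOperators Polynomial

set_option linter.dupNamespace false

namespace Summit.MatrixMultiplication.MatrixMultiplication.Theorems.FarEdgeDescentSignTwistDet

open Literature.Computability.AlgebraicComplexity (prime_det_of_X)

universe u

section Det
variable (K : Type u) [Field K]

/-- The coordinate ring `K[x₀₀,x₀₁,x₁₀,x₁₁]` of `2 × 2` matrices. [folklore] -/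
abbrev Rx := MvPolynomial (Fin 2 × Fin 2) K

/-- The generic `2 × 2` determinant `x₀₀x₁₁ - x₀₁x₁₀`. [folklore] -/
def detX : Rx K :=
  MvPolynomial.X (0, 0) * MvPolynomial.X (1, 1) - MvPolynomial.X (0, 1) * MvPolynomial.X (1, 0)

/-- `detX` is the determinant of the matrix of variables. [folklore] -/
theorem detX_eq_det :
    detX K = (Matrix.of fun i j : Fin 2 => (MvPolynomial.X (i, j) : Rx K)).det := by
  rw [Matrix.det_fin_two]; rfl

/-- **`det X` is prime in `K[x]`.** [folklore] -/
theorem detX_prime : Prime (detX K) := by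
  rw [detX_eq_det]
  exact prime_det_of_X (k := K) (ι := id) Function.injective_id

/-- `det X ≠ 0`. [folklore] -/
theorem detX_ne_zero : detX K ≠ 0 := (detX_prime K).ne_zero

/-- `det X` is a quadratic form. [folklore] -/
theorem detX_isHomogeneous : (detX K).IsHomogeneous 2 :=
  ((MvPolynomial.isHomogeneous_X K (0, 0)).mul (MvPolynomial.isHomogeneous_X K (1, 1))).sub
    ((MvPolynomial.isHomogeneous_X K (0, 1)).mul (MvPolynomial.isHomogeneous_X K (1, 0)))

/-- `deg det X = 2`. [folklore] -/
theorem totalDegree_detX : (detX K).totalDegree = 2 :=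
  (detX_isHomogeneous K).totalDegree (detX_ne_zero K)

/-- `C (2⁻¹) · 2 = 1` in `K[x]` (characteristic `≠ 2`). [folklore] -/
theorem C_inv_two_mul_two (h2 : (2 : K) ≠ 0) : (MvPolynomial.C (2⁻¹ : K) : Rx K) * 2 = 1 := by
  rw [show (2 : Rx K) = MvPolynomial.C 2 from (map_ofNat _ 2).symm, ← map_mul, inv_mul_cancel₀ h2,
    map_one]

end Det

section Factor
variable {K : Type u} [Field K]

/-- The prime `det X` (degree `2`) divides no non-zero linear form. [folklore] -/
theorem not_detX_dvd_of_isHomogeneous_one {l : Rx K} (hl : l.IsHomogeneous 1) (hl0 : l ≠ 0) :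
    ¬ detX K ∣ l := fun h => by
  have h1 := MvPolynomial.totalDegree_le_of_dvd_of_isDomain h hl0
  rw [totalDegree_detX, hl.totalDegree hl0] at h1
  omega

/-- **A product of two linear forms is never a non-zero multiple of `det X`.** [folklore] -/
theorem linear_mul_linear_ne_C_mul_detX {l l' : Rx K} (hl : l.IsHomogeneous 1)
    (hl' : l'.IsHomogeneous 1) {γ : K} (hγ : γ ≠ 0) :
    l * l' ≠ MvPolynomial.C γ * detX K := by
  intro h
  have hne : MvPolynomial.C γ * detX K ≠ 0 :=
    mul_ne_zero (by simpa using hγ) (detX_ne_zero K)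
  have hl0 : l ≠ 0 := fun h0 => hne (by rw [← h, h0, zero_mul])
  have hl'0 : l' ≠ 0 := fun h0 => hne (by rw [← h, h0, mul_zero])
  have hdvd : detX K ∣ l * l' := ⟨MvPolynomial.C γ, by rw [h, mul_comm]⟩
  rcases (detX_prime K).dvd_or_dvd hdvd with h1 | h1
  · exact not_detX_dvd_of_isHomogeneous_one hl hl0 h1
  · exact not_detX_dvd_of_isHomogeneous_one hl' hl'0 h1

/-- A non-zero quadratic form divisible by `det X` is a constant multiple of it. [folklore] -/
theorem eq_C_mul_detX_of_dvd {P : Rx K} (hP : P.IsHomogeneous 2) (hP0 : P ≠ 0)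
    (h : detX K ∣ P) : ∃ κ : K, κ ≠ 0 ∧ P = MvPolynomial.C κ * detX K := by
  obtain ⟨q, hq⟩ := h
  have hq0 : q ≠ 0 := by
    rintro rfl
    exact hP0 (by rw [hq, mul_zero])
  have hdeg : q.totalDegree = 0 := by
    have h1 := congrArg MvPolynomial.totalDegree hq
    rw [MvPolynomial.totalDegree_mul_of_isDomain (detX_ne_zero K) hq0, totalDegree_detX,
      hP.totalDegree hP0] at h1
    omega
  rw [MvPolynomial.totalDegree_eq_zero_iff_eq_C] at hdeg
  refine ⟨q.coeff 0, fun h0 => hq0 (by rw [hdeg, h0, map_zero]), ?_⟩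
  rw [hq, mul_comm]
  congr 1

/-- **`(det X)² = C w · P · Q` with `P`, `Q` quadratic forms forces `P = κ₁ det X`,
`Q = κ₂ det X`** (`κ₁κ₂w = 1`). [folklore] -/
theorem pair_eq_C_mul_detX {w : K} {P Q : Rx K} (hP : P.IsHomogeneous 2) (hQ : Q.IsHomogeneous 2)
    (h : detX K ^ 2 = MvPolynomial.C w * P * Q) :
    (∃ κ₁ : K, κ₁ ≠ 0 ∧ P = MvPolynomial.C κ₁ * detX K) ∧
      (∃ κ₂ : K, κ₂ ≠ 0 ∧ Q = MvPolynomial.C κ₂ * detX K) := by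
  have h0 : detX K ^ 2 ≠ 0 := pow_ne_zero _ (detX_ne_zero K)
  have hw : w ≠ 0 := by
    rintro rfl
    rw [map_zero, zero_mul, zero_mul] at h
    exact h0 h
  have hP0 : P ≠ 0 := by
    rintro rfl
    rw [mul_zero, zero_mul] at h
    exact h0 h
  have hQ0 : Q ≠ 0 := by
    rintro rfl
    rw [mul_zero] at h
    exact h0 h
  have hunit : IsUnit (MvPolynomial.C w : Rx K) := (isUnit_iff_ne_zero.mpr hw).map MvPolynomial.C
  have hdvd : detX K ∣ P * Q := by
    have h1 : detX K ∣ MvPolynomial.C w * (P * Q) := ⟨detX K, by rw [← mul_assoc, ← h]; ring⟩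
    exact hunit.dvd_mul_left.mp h1
  have key : ∀ {P Q : Rx K}, P.IsHomogeneous 2 → P ≠ 0 →
      detX K ^ 2 = MvPolynomial.C w * P * Q → detX K ∣ P →
      (∃ κ₁ : K, κ₁ ≠ 0 ∧ P = MvPolynomial.C κ₁ * detX K) ∧
        (∃ κ₂ : K, κ₂ ≠ 0 ∧ Q = MvPolynomial.C κ₂ * detX K) := by
    intro P Q hP hP0 h hdP
    obtain ⟨κ₁, hκ₁, hP1⟩ := eq_C_mul_detX_of_dvd hP hP0 hdP
    refine ⟨⟨κ₁, hκ₁, hP1⟩, ?_⟩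
    have h2 : detX K * detX K = detX K * (MvPolynomial.C (w * κ₁) * Q) := by
      rw [← pow_two, h, hP1, map_mul]; ring
    have h3 := mul_left_cancel₀ (detX_ne_zero K) h2
    refine ⟨(w * κ₁)⁻¹, inv_ne_zero (mul_ne_zero hw hκ₁), ?_⟩
    rw [h3, ← mul_assoc, ← map_mul, inv_mul_cancel₀ (mul_ne_zero hw hκ₁), map_one, one_mul]
  rcases (detX_prime K).dvd_or_dvd hdvd with h1 | h1
  · exact key hP hP0 h h1
  · have h' : detX K ^ 2 = MvPolynomial.C w * Q * P := by rw [h]; ring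
    exact (key hQ hQ0 h' h1).symm

end Factor

/-! ## Trailing coefficients of `y₀₀y₁₁ ∓ y₀₁y₁₀` -/

section Trailing
variable {K : Type u} [Field K]

/-- If `p ≠ 0` vanishes below order `m₀` and its trailing coefficient is `κ · det X`, then its
coefficient at `m₀` is a (possibly zero) constant multiple of `det X`. [folklore] -/
theorem coeff_eq_C_mul_detX_of_trailing {p : (Rx K)[X]} {m₀ : ℕ} (hp : p ≠ 0)
    (hlow : ∀ k < m₀, p.coeff k = 0) {κ : K}
    (htc : p.trailingCoeff = MvPolynomial.C κ * detX K) :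
    ∃ α : K, p.coeff m₀ = MvPolynomial.C α * detX K := by
  have hle : m₀ ≤ p.natTrailingDegree := Polynomial.le_natTrailingDegree hp hlow
  rcases hle.eq_or_lt with h | h
  · exact ⟨κ, by rw [h]; exact htc⟩
  · exact ⟨0, by rw [Polynomial.coeff_eq_zero_of_lt_natTrailingDegree h, map_zero, zero_mul]⟩

/-- The trailing coefficient of a product `y · y'` whose coefficients are linear forms is a product
of two linear forms. [folklore] -/
theorem trailingCoeff_mul_isHomogeneous {y y' : (Rx K)[X]} (hy : ∀ k, (y.coeff k).IsHomogeneous 1)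
    (hy' : ∀ k, (y'.coeff k).IsHomogeneous 1) :
    ∃ l l' : Rx K, l.IsHomogeneous 1 ∧ l'.IsHomogeneous 1 ∧ (y * y').trailingCoeff = l * l' :=
  ⟨y.trailingCoeff, y'.trailingCoeff, hy _, hy' _, Polynomial.trailingCoeff_mul y y'⟩

/-- **The trailing contradiction.**  If every `ε`-coefficient of the four series `y_b ∈ K[x][ε]`
is a linear form in `x`, then the trailing coefficients of `y₀₀y₁₁ - y₀₁y₁₀` and
`y₀₀y₁₁ + y₀₁y₁₀` cannot both be non-zero multiples of `det X` (characteristic `≠ 2`).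
[cite: BurgisserClausenShokrollahi1997, §15.4] -/
theorem trailing_contradiction (h2 : (2 : K) ≠ 0) (y : Fin 2 × Fin 2 → (Rx K)[X])
    (HY : ∀ b k, ((y b).coeff k).IsHomogeneous 1) {κ₁ κ₂ : K} (hκ₁ : κ₁ ≠ 0) (hκ₂ : κ₂ ≠ 0)
    (h₁ : (y (0, 0) * y (1, 1) - y (0, 1) * y (1, 0)).trailingCoeff =
      MvPolynomial.C κ₁ * detX K)
    (h₂ : (y (0, 0) * y (1, 1) + y (0, 1) * y (1, 0)).trailingCoeff =
      MvPolynomial.C κ₂ * detX K) : False := by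
  set u := y (0, 0) * y (1, 1) with hu
  set v := y (0, 1) * y (1, 0) with hv
  have hC : ∀ {κ : K}, κ ≠ 0 → MvPolynomial.C κ * detX K ≠ 0 := fun hκ =>
    mul_ne_zero (by simpa using hκ) (detX_ne_zero K)
  -- a product of two of the `y`'s never has trailing coefficient `κ · det X`, `κ ≠ 0`
  have hprod : ∀ (b b' : Fin 2 × Fin 2) {κ : K}, κ ≠ 0 →
      (y b * y b').trailingCoeff ≠ MvPolynomial.C κ * detX K := by
    intro b b' κ hκ h
    obtain ⟨l, l', hl, hl', hll⟩ := trailingCoeff_mul_isHomogeneous (HY b) (HY b')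
    exact linear_mul_linear_ne_C_mul_detX hl hl' hκ (hll ▸ h)
  by_cases hu0 : u = 0
  · rw [hu0, zero_add] at h₂
    exact hprod _ _ hκ₂ h₂
  by_cases hv0 : v = 0
  · rw [hv0, sub_zero] at h₁
    exact hprod _ _ hκ₁ h₁
  -- both non-zero: look at the least order `m₀`
  have hsub0 : u - v ≠ 0 := fun h => hC hκ₁ (by rw [← h₁, h, Polynomial.trailingCoeff_zero])
  have hadd0 : u + v ≠ 0 := fun h => hC hκ₂ (by rw [← h₂, h, Polynomial.trailingCoeff_zero])
  set m₀ := min u.natTrailingDegree v.natTrailingDegree with hm₀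
  have hlowu : ∀ k < m₀, u.coeff k = 0 := fun k hk =>
    Polynomial.coeff_eq_zero_of_lt_natTrailingDegree (lt_of_lt_of_le hk (min_le_left _ _))
  have hlowv : ∀ k < m₀, v.coeff k = 0 := fun k hk =>
    Polynomial.coeff_eq_zero_of_lt_natTrailingDegree (lt_of_lt_of_le hk (min_le_right _ _))
  obtain ⟨αm, hαm⟩ := coeff_eq_C_mul_detX_of_trailing hsub0
    (fun k hk => by rw [Polynomial.coeff_sub, hlowu k hk, hlowv k hk, sub_zero]) h₁
  obtain ⟨αp, hαp⟩ := coeff_eq_C_mul_detX_of_trailing hadd0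
    (fun k hk => by rw [Polynomial.coeff_add, hlowu k hk, hlowv k hk, add_zero]) h₂
  rw [Polynomial.coeff_sub] at hαm
  rw [Polynomial.coeff_add] at hαp
  have E3 := C_inv_two_mul_two K h2
  have ha : u.coeff m₀ = MvPolynomial.C (2⁻¹ * (αm + αp)) * detX K := by
    rw [map_mul, map_add]
    linear_combination (MvPolynomial.C (2⁻¹ : K)) * hαm + (MvPolynomial.C (2⁻¹ : K)) * hαp
      - u.coeff m₀ * E3
  have hb : v.coeff m₀ = MvPolynomial.C (2⁻¹ * (αp - αm)) * detX K := by
    rw [map_mul, map_sub]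
    linear_combination (-MvPolynomial.C (2⁻¹ : K)) * hαm + (MvPolynomial.C (2⁻¹ : K)) * hαp
      - v.coeff m₀ * E3
  -- `m₀` is attained by `u` or by `v`; there the coefficient is the (non-zero) trailing one
  rcases min_choice u.natTrailingDegree v.natTrailingDegree with hm | hm
  · have htc : u.trailingCoeff = MvPolynomial.C (2⁻¹ * (αm + αp)) * detX K := by
      rw [Polynomial.trailingCoeff, ← hm]; exact ha
    have hne : (2⁻¹ * (αm + αp) : K) ≠ 0 := by
      intro h0
      rw [h0, map_zero, zero_mul, Polynomial.trailingCoeff_eq_zero] at htc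
      exact hu0 htc
    exact hprod _ _ hne htc
  · have htc : v.trailingCoeff = MvPolynomial.C (2⁻¹ * (αp - αm)) * detX K := by
      rw [Polynomial.trailingCoeff, ← hm]; exact hb
    have hne : (2⁻¹ * (αp - αm) : K) ≠ 0 := by
      intro h0
      rw [h0, map_zero, zero_mul, Polynomial.trailingCoeff_eq_zero] at htc
      exact hv0 htc
    exact hprod _ _ hne htc

end Trailing

end Summit.MatrixMultiplication.MatrixMultiplication.Theorems.FarEdgeDescentSignTwistDet

end
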